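import Summits.QuantumFields.BalabanUV.T4Continuum.Support.VariationalCovariantTower
import Summits.QuantumFields.BalabanUV.T4Continuum.Support.VariationalCovariantAssemblySqrt
import Summits.QuantumFields.BalabanUV.T4Continuum.Support.VariationalCovariantUpperSqrt
import Summits.QuantumFields.BalabanUV.T4Continuum.Support.VariationalCovariantLevelZero

/-!
# T⁴ programme, spine node NE2 (U1a), lane P2 — THE k-INDEXED TOWER LAW OF THE SCALAR COVARIANT SPECIES IN THE HONEST (sqrt) ONE′ WORLD:
# `OneStepAveragedLaw (fun _ ↦ 1) 1 (k ↦ X_k) e` for King's charged scalar with EVERY binder a data shape or an open leaf's typed shape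
# (ONE′ in leaf-01's honest covariant shape, REG⁺, UB⁺ at every level), the defects `e_k` explicit
# (`t4/skeletons/NE2-t4-ne2-p2.md` v0.8 §3/§7 bookkeeping; cell `pub-balaban`, NE2 formalisation swarm, unit `b2b-balaban-t4-ne2-formalise-leaf-02`
# gen 3, supplier to lineage t4-ne2-p2; consumes `VariationalCovariantAssemblySqrt.scalar_pair_bracket_sqrt` (leaf-01 gen 2) and this seat's
# `VariationalCovariantTower` BY NAME)

HONEST FRAMING (T4-DAG p. 1).  Rung (B)+1 only — NOT infinite volume, NOT a mass gap, NOT Clay.  Node NE2 is NOT IN PRINT and NOT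
proved here.  MODEL LEVEL: U(1) bond phases, site transports, global unitary frames and block phases are DATA; global small-field frame
conditions and mismatch absorption as in `VariationalCovariantScalarPair` (p211992); scalar (0-form) sector.  This file is PLUMBING: at every
level `n = L^k` the canonical-pair bracket `scalar_pair_bracket_sqrt` is applied VERBATIM, its fine-level UB⁺ binder is fed from the level-`k+1`
UB⁺ through `VariationalCovariantTower.ub_transport` (COMP⁺), and the brackets are read into the operator norm by
`VariationalCovariantTower.oneStepAveragedLaw_effSc_of_pairs`.  The analytic leaves stay HYPOTHESES of exactly their typed shapes: ONE′ (honest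
covariant shape, open), REG⁺ (coarse-minimiser shape), UB⁺ AT EVERY LEVEL (to be discharged BY NAME by `VariationalCovariantLevelZero.ub_level_zero`
+ the UB⁺-induction `ub_tower` / its sqrt re-run).  Nothing printed is a hypothesis; no `def … : Prop` fact; no `sorry`; axioms standard.
HONEST DEPENDENCY (cell, verbatim): continuum YM on T⁴ ⇐ BetaPertH ∧ nine spine estimates (0/9 proved); BetaPertH ⇐ (D1) ∧ (D4) ∧ CAP+tail;
G-an2-4 gates asym, D1 and NE2/3/4.

CONTENTS.  §1 `eFED`, `eONE` (the two defects of `scalar_pair_bracket_sqrt`, `C_P = 1088d + 128`); §2 `ub_mono`, `ubf_of_succ` (level-`k+1`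
UB⁺ ⟹ the pair's fine-level UB⁺ at level `k`, via COMP⁺); §3 `bracket_sqrt_at`, **`oneStepAveragedLaw_scalarTower_sqrt`** (UB⁺ ∕ ONE′ ∕ REG⁺ as
per-level binders); §4 **`ubAll_of_ub_tower`** (UB⁺ at every level on the CONCRETE tower from `ub_level_zero` + the owner's abstract `ub_tower`:
`W k := level-L^k fields`, `Q₁ k := Q1tow`, `hcomp := Qk_compT_eq_comp`, `hONE` through `blockSpin_Q1tow` — additive ONE⁺ shape); §5
**`oneStepAveragedLaw_scalarTower_additive`** (additive world, UB⁺ DISCHARGED); §6 **`ubAll_of_ub_tower_sqrt`**, **`oneStepAveragedLaw_scalarTower_sqrt_ub`**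
(honest sqrt world, UB⁺ DISCHARGED by `ub_tower_sqrt` = p213284, LANDED by leaf-01 gen 2 — v1.1 ERRATUM: §6's «leaf-09's» reads «leaf-01 gen 2's»; binders = data identities, frames, mismatch, ONE′, REG⁺ only;
`Λ_k = LamSeq (4d) (j ↦ eUB d C_R ε₁,j δ′_j) k`).  The road owner's «P2-END» (`VariationalCovariantEnd`) plugs ONE′ ∕ REG⁺ ∕ the class bounds.
-/

noncomputable section

open scoped Matrix ComplexConjugate ComplexOrder Matrix.Norms.L2Operator BigOperators

namespace Summit.QuantumFields.BalabanUV.T4Continuum.VariationalCovariantTowerLaw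

open Summit.QuantumFields.BalabanUV.T4Continuum.VariationalTransfer (blockSpin)
open Summit.QuantumFields.BalabanUV.T4Continuum.CovariantAveragingTower (OneStepAveragedLaw)
open Summit.QuantumFields.BalabanUV.T4Continuum.VariationalCovariantEffective (effSc)
open Summit.QuantumFields.BalabanUV.T4Continuum.VariationalCovariantTower (compT Rtr Q1tow Qk_compT_eq_comp blockSpin_Q1tow ub_transport
  oneStepAveragedLaw_effSc_of_pairs)
open Summit.QuantumFields.BalabanUV.T4Continuum.VariationalCovariantUpper (LamSeq ub_tower LamSeq_add_one_nonneg)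
open Summit.QuantumFields.BalabanUV.T4Continuum.VariationalCovariantUpperSqrt (ub_tower_sqrt LamSeq_nonneg)
open Summit.QuantumFields.BalabanUV.T4Continuum.VariationalCovariantLevelZero (ub_level_zero)
open Summit.QuantumFields.BalabanUV.T4Continuum.VariationalCovariantAssemblySqrt (scalar_pair_bracket_sqrt)
open Literature.MathematicalPhysics.QuantumFieldTheory.Balaban1983to89.B5Prop11Lower (nsq nsq_nonneg)
open Literature.MathematicalPhysics.QuantumFieldTheory.Balaban1983to89.B5Prop11Plancherel (Tor fine unitVec)
open Literature.MathematicalPhysics.QuantumFieldTheory.Balaban1983to89.B5Block118 (bpt)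
open Summit.QuantumFields.BalabanUV.T4Continuum.VariationalCovariantFederbush (mis)
open Summit.QuantumFields.BalabanUV.T4Continuum.VariationalCovariantScalarPair (Sc Sf qW qV Qk Q1 qW_le_coarse continuous_Qc
  continuous_sum_dirU Q1_surjective norm_sq_le_qW Sc_nonneg)

/-! ## §1 The two defects of the sqrt bracket -/

/-- the FED⁺-side defect `e = 2δ√(Λ·C_P(Λ+1)) + δ²·C_P(Λ+1)`, `C_P = 1088d + 128` (`scalar_pair_bracket_sqrt`'s first constant). [folklore] -/
def eFED (d : ℕ) (δ Λ : ℝ) : ℝ :=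
  2 * δ * Real.sqrt (Λ * ((1088 * d + 128) * (Λ + 1))) + δ ^ 2 * ((1088 * d + 128) * (Λ + 1))

/-- the ONE′/REG⁺-side defect `e′ = ε₁C_R(Λ+1) + 2δ′√((Λ + ε₁C_R(Λ+1))·C_P(Λ+1)) + δ′²·C_P(Λ+1)` (`scalar_pair_bracket_sqrt`'s second constant).
[folklore] -/
def eONE (d : ℕ) (Λ CR ε₁ δ' : ℝ) : ℝ :=
  ε₁ * CR * (Λ + 1) + 2 * δ' * Real.sqrt ((Λ + ε₁ * CR * (Λ + 1)) * ((1088 * d + 128) * (Λ + 1))) + δ' ^ 2 * ((1088 * d + 128) * (Λ + 1))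

/-- `eFED ≥ 0` for `δ ≥ 0`, `Λ ≥ 0`. [folklore] -/
theorem eFED_nonneg (d : ℕ) {δ Λ : ℝ} (hδ : 0 ≤ δ) (hΛ : 0 ≤ Λ) : 0 ≤ eFED d δ Λ := by
  unfold eFED; positivity

/-- `eONE ≥ 0` for nonnegative parameters. [folklore] -/
theorem eONE_nonneg (d : ℕ) {Λ CR ε₁ δ' : ℝ} (hΛ : 0 ≤ Λ) (hCR : 0 ≤ CR) (hε₁ : 0 ≤ ε₁) (hδ' : 0 ≤ δ') : 0 ≤ eONE d Λ CR ε₁ δ' := by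
  unfold eONE; positivity

/-! ## §2 UB⁺ bookkeeping along the tower -/

section Tower

variable {d : ℕ} (L : ℕ) [NeZero L] (M : Fin d → ℕ) [hM : ∀ μ, NeZero (M μ)]
variable (Rc : (k : ℕ) → Tor (fine (L ^ k) M) → Fin d → ℂ) (T : (k : ℕ) → Tor (fine (L ^ k) M) → ℂ)
  (R' : (k : ℕ) → Tor (fine L (fine (L ^ k) M)) → Fin d → ℂ) (T' : (k : ℕ) → Tor (fine L (fine (L ^ k) M)) → ℂ)

/-- UB⁺ is monotone in the constant. [folklore] -/
theorem ub_mono (k : ℕ) {Λ Λ' : ℝ} (hΛ : Λ ≤ Λ')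
    (h : ∀ μ : Tor M → ℂ, ∃ f, Qk (L ^ k) M (T k) f = μ ∧ Sc (L ^ k) M (Rc k) f ≤ Λ * nsq μ) :
    ∀ μ : Tor M → ℂ, ∃ f, Qk (L ^ k) M (T k) f = μ ∧ Sc (L ^ k) M (Rc k) f ≤ Λ' * nsq μ := by
  intro μ
  obtain ⟨f, hf, hb⟩ := h μ
  exact ⟨f, hf, hb.trans (mul_le_mul_of_nonneg_right hΛ (nsq_nonneg μ))⟩

/-- **level-`k+1` UB⁺ (coarse form) ⟹ the pair's fine-level UB⁺ at level `k`** (COMP⁺: the level-`k+1` transports are the composite ones and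
its bond phases the fine ones read through `sites`; `L^(k+1) = L^k·L` by `rfl`). [folklore] -/
theorem ubf_of_succ (hTcomp : ∀ k, T (k + 1) = compT (L ^ k) L M (T k) (T' k)) (hRtr : ∀ k, Rc (k + 1) = Rtr (L ^ k) L M (R' k))
    (k : ℕ) {Λ : ℝ} (h : ∀ μ : Tor M → ℂ, ∃ g, Qk (L ^ (k + 1)) M (T (k + 1)) g = μ ∧ Sc (L ^ (k + 1)) M (Rc (k + 1)) g ≤ Λ * nsq μ) :
    ∀ μ : Tor M → ℂ, ∃ f', Qk (L ^ k) M (T k) (Q1 (L ^ k) L M (T' k) f') = μ ∧ Sf (L ^ k) L M (R' k) f' ≤ Λ * nsq μ := by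
  intro μ
  obtain ⟨g, hg, hb⟩ := h μ
  have hQ : Qk (L ^ (k + 1)) M (T (k + 1)) = Qk (L ^ k * L) M (compT (L ^ k) L M (T k) (T' k)) := by
    rw [hTcomp k]; rfl
  have hS : Sc (L ^ (k + 1)) M (Rc (k + 1)) = Sc (L ^ k * L) M (Rtr (L ^ k) L M (R' k)) := by
    rw [hRtr k]; rfl
  rw [hQ] at hg
  rw [hS] at hb
  exact (ub_transport (L ^ k) L M).mpr ⟨g, hg, hb⟩

/-! ## §3 The per-level bracket and the tower law -/

variable (G : (k : ℕ) → Tor (fine (L ^ k) M) → ℂ) (c : (k : ℕ) → Tor M → ℂ) (mG mB : ℕ → ℝ)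
  (G' : (k : ℕ) → Tor (fine L (fine (L ^ k) M)) → ℂ) (c' : (k : ℕ) → Tor (fine (L ^ k) M) → ℂ) (mG' mB' : ℕ → ℝ)
  (m : ℕ → ℝ) (Λ : ℕ → ℝ) (CR : ℝ) (ε₁ δ' : ℕ → ℝ) (ρ : (k : ℕ) → (Tor (fine (L ^ k) M) → ℂ) → ℝ)

/-- **THE CANONICAL-PAIR BRACKET AT LEVEL `n = L^k`** (`scalar_pair_bracket_sqrt` verbatim, with `Λ := Λ (k+1)` for both UB⁺ binders — the
coarse one by monotonicity from `Λ k ≤ Λ (k+1)`, the fine one from the level-`k+1` UB⁺ through COMP⁺). [folklore] -/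
theorem bracket_sqrt_at
    (hTcomp : ∀ k, T (k + 1) = compT (L ^ k) L M (T k) (T' k)) (hRtr : ∀ k, Rc (k + 1) = Rtr (L ^ k) L M (R' k))
    (hG : ∀ k x, ‖G k x‖ = 1) (hc : ∀ k z, ‖c k z‖ ≤ 1)
    (hframe : ∀ k x μ, ‖G k (x + unitVec (fine (L ^ k) M) μ) - G k x * Rc k x μ‖ ≤ mG k)
    (hblock : ∀ k z j, ‖G k (bpt (L ^ k) M z j) - c k z * T k (bpt (L ^ k) M z j)‖ ≤ mB k)
    (hsmall : ∀ k, 16 * (d : ℝ) ^ 2 * (((L ^ k : ℕ) : ℝ) * mG k) ^ 2 + 4 * mB k ^ 2 ≤ 1 / 2)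
    (hG' : ∀ k x, ‖G' k x‖ = 1) (hc' : ∀ k y, ‖c' k y‖ ≤ 1)
    (hframe' : ∀ k x μ, ‖G' k (x + unitVec (fine L (fine (L ^ k) M)) μ) - G' k x * R' k x μ‖ ≤ mG' k)
    (hblock' : ∀ k y j, ‖G' k (bpt L (fine (L ^ k) M) y j) - c' k y * T' k (bpt L (fine (L ^ k) M) y j)‖ ≤ mB' k)
    (hsmall' : ∀ k, 16 * (d : ℝ) ^ 2 * ((L : ℝ) * mG' k) ^ 2 + 4 * mB' k ^ 2 ≤ 1 / 2)
    (hR' : ∀ k x μ, ‖R' k x μ‖ ≤ 1) (hT'le : ∀ k x, ‖T' k x‖ ≤ 1) (hT'1 : ∀ k x, ‖T' k x‖ = 1) (hm : ∀ k, 0 ≤ m k)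
    (hmis : ∀ k y μ j, ‖mis L (fine (L ^ k) M) (Rc k) (R' k) (T' k) y μ j‖ ≤ m k)
    (habsorb : ∀ k, 512 * (d : ℝ) ^ 2 * (((L ^ k : ℕ) : ℝ) * m k) ^ 2 ≤ 1 / 2)
    (hΛ0 : ∀ k, 0 ≤ Λ k) (hΛmono : ∀ k, Λ k ≤ Λ (k + 1)) (hCR : 0 ≤ CR) (hε₁ : ∀ k, 0 ≤ ε₁ k) (hδ' : ∀ k, 0 ≤ δ' k)
    (hρ0 : ∀ k f, 0 ≤ ρ k f)
    -- leaf UB⁺ at every level (coarse form; from `ub_level_zero` + the UB⁺-induction, by name)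
    (hUB : ∀ k (μ : Tor M → ℂ), ∃ f, Qk (L ^ k) M (T k) f = μ ∧ Sc (L ^ k) M (Rc k) f ≤ Λ k * nsq μ)
    -- leaf ONE′ in the honest covariant shape, and leaf REG⁺, at every level
    (hONE : ∀ k f, blockSpin (Q1 (L ^ k) L M (T' k)) (Sf (L ^ k) L M (R' k)) f
      ≤ (Real.sqrt (Sc (L ^ k) M (Rc k) f + ε₁ k * ρ k f) + δ' k * Real.sqrt (qW (L ^ k) M f)) ^ 2)
    (hREG : ∀ k (μ : Tor M → ℂ) f, Qk (L ^ k) M (T k) f = μ → (∀ g, Qk (L ^ k) M (T k) g = μ → Sc (L ^ k) M (Rc k) f ≤ Sc (L ^ k) M (Rc k) g) →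
      ρ k f ≤ CR * (Sc (L ^ k) M (Rc k) f + nsq μ))
    (k : ℕ) (μ : Tor M → ℂ) :
    blockSpin (Qk (L ^ k) M (T k)) (Sc (L ^ k) M (Rc k)) μ
        ≤ blockSpin (Qk (L ^ k) M (T k) ∘ Q1 (L ^ k) L M (T' k)) (Sf (L ^ k) L M (R' k)) μ
          + eFED d (Real.sqrt d * (((L ^ k : ℕ) : ℝ) * m k)) (Λ (k + 1)) * nsq μ ∧
      blockSpin (Qk (L ^ k) M (T k) ∘ Q1 (L ^ k) L M (T' k)) (Sf (L ^ k) L M (R' k)) μ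
        ≤ blockSpin (Qk (L ^ k) M (T k)) (Sc (L ^ k) M (Rc k)) μ + eONE d (Λ (k + 1)) CR (ε₁ k) (δ' k) * nsq μ := by
  have hUBc := ub_mono L M Rc T k (hΛmono k) (hUB k)
  have hUBf := ubf_of_succ L M Rc T R' T' hTcomp hRtr k (hUB (k + 1))
  have h := scalar_pair_bracket_sqrt (L ^ k) L M (hG k) (hc k) (hframe k) (hblock k) (hsmall k) (hG' k) (hc' k) (hframe' k)
    (hblock' k) (hsmall' k) (hR' k) (hT'le k) (hT'1 k) (hm k) (hmis k) (habsorb k) (hΛ0 (k + 1)) hCR (hε₁ k) (hδ' k) (hρ0 k)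
    hUBc hUBf (hONE k) (hREG k) μ
  unfold eFED eONE
  exact h

/-- **THE TOWER LAW OF THE SCALAR COVARIANT SPECIES (honest ONE′ world)**: King's charged scalar along `n_k = L^k` (coarse data `(Rc k, T k)`,
one-step data `(R′ k, T′ k)` tied by COMP⁺, per-level small-field frames, mismatch absorption) with UB⁺ (every level), ONE′, REG⁺ as binders ⟹
`OneStepAveragedLaw (fun _ ↦ 1) 1 (k ↦ effSc (L^k) M (Rc k) (T k) a) (k ↦ max (eFED d (√d·(L^k·m_k)) Λ_{k+1}) (eONE d Λ_{k+1} C_R ε₁,k δ′_k))`.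
Row NE2's wall SHAPE; nothing of NE3; NE2 NOT proved. [folklore] -/
theorem oneStepAveragedLaw_scalarTower_sqrt
    (hTcomp : ∀ k, T (k + 1) = compT (L ^ k) L M (T k) (T' k)) (hRtr : ∀ k, Rc (k + 1) = Rtr (L ^ k) L M (R' k))
    (hT : ∀ k x, ‖T k x‖ = 1)
    (hG : ∀ k x, ‖G k x‖ = 1) (hc : ∀ k z, ‖c k z‖ ≤ 1)
    (hframe : ∀ k x μ, ‖G k (x + unitVec (fine (L ^ k) M) μ) - G k x * Rc k x μ‖ ≤ mG k)
    (hblock : ∀ k z j, ‖G k (bpt (L ^ k) M z j) - c k z * T k (bpt (L ^ k) M z j)‖ ≤ mB k)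
    (hsmall : ∀ k, 16 * (d : ℝ) ^ 2 * (((L ^ k : ℕ) : ℝ) * mG k) ^ 2 + 4 * mB k ^ 2 ≤ 1 / 2)
    (hG' : ∀ k x, ‖G' k x‖ = 1) (hc' : ∀ k y, ‖c' k y‖ ≤ 1)
    (hframe' : ∀ k x μ, ‖G' k (x + unitVec (fine L (fine (L ^ k) M)) μ) - G' k x * R' k x μ‖ ≤ mG' k)
    (hblock' : ∀ k y j, ‖G' k (bpt L (fine (L ^ k) M) y j) - c' k y * T' k (bpt L (fine (L ^ k) M) y j)‖ ≤ mB' k)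
    (hsmall' : ∀ k, 16 * (d : ℝ) ^ 2 * ((L : ℝ) * mG' k) ^ 2 + 4 * mB' k ^ 2 ≤ 1 / 2)
    (hR' : ∀ k x μ, ‖R' k x μ‖ ≤ 1) (hT'le : ∀ k x, ‖T' k x‖ ≤ 1) (hT'1 : ∀ k x, ‖T' k x‖ = 1) (hm : ∀ k, 0 ≤ m k)
    (hmis : ∀ k y μ j, ‖mis L (fine (L ^ k) M) (Rc k) (R' k) (T' k) y μ j‖ ≤ m k)
    (habsorb : ∀ k, 512 * (d : ℝ) ^ 2 * (((L ^ k : ℕ) : ℝ) * m k) ^ 2 ≤ 1 / 2)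
    (hΛ0 : ∀ k, 0 ≤ Λ k) (hΛmono : ∀ k, Λ k ≤ Λ (k + 1)) (hCR : 0 ≤ CR) (hε₁ : ∀ k, 0 ≤ ε₁ k) (hδ' : ∀ k, 0 ≤ δ' k)
    (hρ0 : ∀ k f, 0 ≤ ρ k f)
    (hUB : ∀ k (μ : Tor M → ℂ), ∃ f, Qk (L ^ k) M (T k) f = μ ∧ Sc (L ^ k) M (Rc k) f ≤ Λ k * nsq μ)
    (hONE : ∀ k f, blockSpin (Q1 (L ^ k) L M (T' k)) (Sf (L ^ k) L M (R' k)) f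
      ≤ (Real.sqrt (Sc (L ^ k) M (Rc k) f + ε₁ k * ρ k f) + δ' k * Real.sqrt (qW (L ^ k) M f)) ^ 2)
    (hREG : ∀ k (μ : Tor M → ℂ) f, Qk (L ^ k) M (T k) f = μ → (∀ g, Qk (L ^ k) M (T k) g = μ → Sc (L ^ k) M (Rc k) f ≤ Sc (L ^ k) M (Rc k) g) →
      ρ k f ≤ CR * (Sc (L ^ k) M (Rc k) f + nsq μ))
    {a : ℝ} (ha : 0 < a) :
    OneStepAveragedLaw (ι := fun _ => Tor M) (fun _ => (1 : Matrix (Tor M) (Tor M) ℂ)) 1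
      (fun k => effSc (L ^ k) M (Rc k) (T k) a)
      (fun k => max (eFED d (Real.sqrt d * (((L ^ k : ℕ) : ℝ) * m k)) (Λ (k + 1))) (eONE d (Λ (k + 1)) CR (ε₁ k) (δ' k))) := by
  refine oneStepAveragedLaw_effSc_of_pairs L M Rc T R' T' hT (CP := fun _ => 1088 * d + 128)
    (fun k f => qW_le_coarse (L ^ k) M (hG k) (hc k) (hframe k) (hblock k) (hsmall k) f) hTcomp hRtr ha _ _
    (fun k => eFED_nonneg d (by have := hm k; positivity) (hΛ0 (k + 1))) fun k μ => ?_
  exact bracket_sqrt_at L M Rc T R' T' G c mG mB G' c' mG' mB' m Λ CR ε₁ δ' ρ hTcomp hRtr hG hc hframe hblock hsmall hG' hc'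
    hframe' hblock' hsmall' hR' hT'le hT'1 hm hmis habsorb hΛ0 hΛmono hCR hε₁ hδ' hρ0 hUB hONE hREG k μ

/-! ## §4 UB⁺ at every level on the CONCRETE tower from the owner's abstract induction `ub_tower` (the instantiation pattern) -/

omit [NeZero L] hM in
/-- precomposition with `sites⁻¹` is onto. [folklore] -/
theorem comp_symm_surjective (n : ℕ) :
    Function.Surjective fun g : Tor (fine (n * L) M) → ℂ =>
      g ∘ (Literature.MathematicalPhysics.QuantumFieldTheory.Balaban1983to89.B5Composition116.sites n L M).symm := by
  intro h
  refine ⟨h ∘ Literature.MathematicalPhysics.QuantumFieldTheory.Balaban1983to89.B5Composition116.sites n L M, ?_⟩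
  funext y; simp

/-- the one-step tower average `Q1tow` is continuous. [folklore] -/
theorem continuous_Q1tow (n : ℕ) [NeZero n] (T' : Tor (fine L (fine n M)) → ℂ) : Continuous (Q1tow n L M T') := by
  unfold Q1tow
  exact (continuous_Qc T').comp (continuous_pi fun y => continuous_apply _)

/-- the one-step tower average `Q1tow` is onto for unimodular transports. [folklore] -/
theorem surjective_Q1tow (n : ℕ) [NeZero n] {T' : Tor (fine L (fine n M)) → ℂ} (hT1 : ∀ x, ‖T' x‖ = 1) :
    Function.Surjective (Q1tow n L M T') := by
  unfold Q1tow
  exact (Q1_surjective n L M T' hT1).comp (comp_symm_surjective L M n)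

/-- **UB⁺ AT EVERY LEVEL ON THE CONCRETE TOWER** from `ub_level_zero` and the owner's abstract induction `VariationalCovariantUpper.ub_tower`
instantiated with `W k := (Tor (fine (L^k) M) → ℂ)`, `Q₁ k := Q1tow (L^k) L M (T′ k)` (`hcomp` = COMP⁺ `Qk_compT_eq_comp`, `hONE` through
`blockSpin_Q1tow`), in `ub_tower`'s ADDITIVE ONE⁺ shape (sqrt twin: §6): `Λ_k = LamSeq (4d) (j ↦ ε₁,j C_R + ε₂,j C_P) k`. [folklore] -/
theorem ubAll_of_ub_tower
    (hTcomp : ∀ k, T (k + 1) = compT (L ^ k) L M (T k) (T' k)) (hRtr : ∀ k, Rc (k + 1) = Rtr (L ^ k) L M (R' k))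
    (hT : ∀ k x, ‖T k x‖ = 1) (hRc0 : ∀ y μ, ‖Rc 0 y μ‖ ≤ 1)
    (hG : ∀ k x, ‖G k x‖ = 1) (hc : ∀ k z, ‖c k z‖ ≤ 1)
    (hframe : ∀ k x μ, ‖G k (x + unitVec (fine (L ^ k) M) μ) - G k x * Rc k x μ‖ ≤ mG k)
    (hblock : ∀ k z j, ‖G k (bpt (L ^ k) M z j) - c k z * T k (bpt (L ^ k) M z j)‖ ≤ mB k)
    (hsmall : ∀ k, 16 * (d : ℝ) ^ 2 * (((L ^ k : ℕ) : ℝ) * mG k) ^ 2 + 4 * mB k ^ 2 ≤ 1 / 2)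
    (hT'1 : ∀ k x, ‖T' k x‖ = 1) (hCR : 0 ≤ CR) {ε₂ : ℕ → ℝ} (hε₁ : ∀ k, 0 ≤ ε₁ k) (hε₂ : ∀ k, 0 ≤ ε₂ k)
    (hONEadd : ∀ k f, blockSpin (Q1 (L ^ k) L M (T' k)) (Sf (L ^ k) L M (R' k)) f
      ≤ Sc (L ^ k) M (Rc k) f + ε₁ k * ρ k f + ε₂ k * qW (L ^ k) M f)
    (hREG : ∀ k (μ : Tor M → ℂ) f, Qk (L ^ k) M (T k) f = μ → (∀ g, Qk (L ^ k) M (T k) g = μ → Sc (L ^ k) M (Rc k) f ≤ Sc (L ^ k) M (Rc k) g) →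
      ρ k f ≤ CR * (Sc (L ^ k) M (Rc k) f + nsq μ)) :
    ∀ k (μ : Tor M → ℂ), ∃ f, Qk (L ^ k) M (T k) f = μ ∧
      Sc (L ^ k) M (Rc k) f ≤ LamSeq (4 * d) (fun j => ε₁ j * CR + ε₂ j * (1088 * d + 128)) k * nsq μ := by
  refine ub_tower (W := fun k => Tor (fine (L ^ k) M) → ℂ) (Z := Tor M → ℂ)
    (Q₁ := fun k => Q1tow (L ^ k) L M (T' k)) (Qk := fun k => Qk (L ^ k) M (T k)) ?_
    (S := fun k => Sc (L ^ k) M (Rc k)) (q := fun k => qW (L ^ k) M) (ρ := ρ) (qZ := nsq)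
    (fun k => continuous_Qc (T k)) (fun k => continuous_Q1tow L M (L ^ k) (T' k)) (fun k => ?_)
    (fun k => surjective_Q1tow L M (L ^ k) (hT'1 k)) (fun k f => Sc_nonneg (L ^ k) M (Rc k) f)
    (κ := fun k => (((L ^ k : ℕ) : ℝ)) ^ d) (CP := 1088 * d + 128) (CR := CR) (Λ₀ := 4 * d) (ε₁ := ε₁) (ε₂ := ε₂)
    (fun k => by positivity) (by positivity) hCR hε₁ hε₂
    (fun k f => norm_sq_le_qW (L ^ k) M f)
    (fun k f => qW_le_coarse (L ^ k) M (hG k) (hc k) (hframe k) (hblock k) (hsmall k) f)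
    (fun k f => ?_) hREG (fun μ => ub_level_zero M hRc0 (hT 0) μ)
  · -- hcomp: COMP⁺ on the concrete tower
    intro k
    show Qk (L ^ (k + 1)) M (T (k + 1)) = Qk (L ^ k) M (T k) ∘ Q1tow (L ^ k) L M (T' k)
    rw [hTcomp k]
    exact Qk_compT_eq_comp (L ^ k) L M (T k) (T' k)
  · -- continuity of the covariant form
    exact continuous_sum_dirU (Rc k) _
  · -- hONE in tower shape from the canonical-pair ONE⁺
    show blockSpin (Q1tow (L ^ k) L M (T' k)) (Sc (L ^ (k + 1)) M (Rc (k + 1))) f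
      ≤ Sc (L ^ k) M (Rc k) f + ε₁ k * ρ k f + ε₂ k * qW (L ^ k) M f
    have hS : Sc (L ^ (k + 1)) M (Rc (k + 1)) = Sc (L ^ k * L) M (Rtr (L ^ k) L M (R' k)) := by
      rw [hRtr k]; rfl
    rw [hS, blockSpin_Q1tow]
    exact hONEadd k f

/-! ## §5 The additive-world END with UB⁺ DISCHARGED (binders: data, frames, ONE⁺ (additive shape), REG⁺ only) -/

/-- `LamSeq` is nondecreasing for nonnegative defects. [folklore] -/
theorem LamSeq_le_succ {Λ₀ : ℝ} {e : ℕ → ℝ} (hΛ₀ : 0 ≤ Λ₀ + 1) (he : ∀ j, 0 ≤ e j) (k : ℕ) :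
    LamSeq Λ₀ e k ≤ LamSeq Λ₀ e (k + 1) := by
  show LamSeq Λ₀ e k ≤ LamSeq Λ₀ e k + e k * (LamSeq Λ₀ e k + 1)
  have := mul_nonneg (he k) (LamSeq_add_one_nonneg hΛ₀ he k)
  linarith

/-- **THE TOWER LAW WITH UB⁺ DISCHARGED (additive ONE⁺ world)**: binders = COMP⁺ data identities, unimodular transports, contractive phases,
per-level small-field frames, mismatch absorption, ONE⁺ (`scalar_pair_bracket`'s ADDITIVE shape — adequate for transport-flat one-step data), REG⁺;
UB⁺ DISCHARGED inside by `ubAll_of_ub_tower` ⟹ `OneStepAveragedLaw (fun _ ↦ 1) 1 (k ↦ effSc (L^k) M (Rc k) (T k) a) (k ↦ max (eFED …) ((ε₁,k C_R +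
ε₂,k C_P)(Λ_{k+1} + 1)))`, `Λ = LamSeq (4d) (j ↦ ε₁,j C_R + ε₂,j C_P)`.  Sqrt twin: §6.  Nothing of NE3; NE2 NOT proved. [folklore] -/
theorem oneStepAveragedLaw_scalarTower_additive
    (hTcomp : ∀ k, T (k + 1) = compT (L ^ k) L M (T k) (T' k)) (hRtr : ∀ k, Rc (k + 1) = Rtr (L ^ k) L M (R' k))
    (hT : ∀ k x, ‖T k x‖ = 1) (hRc0 : ∀ y μ, ‖Rc 0 y μ‖ ≤ 1)
    (hG : ∀ k x, ‖G k x‖ = 1) (hc : ∀ k z, ‖c k z‖ ≤ 1)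
    (hframe : ∀ k x μ, ‖G k (x + unitVec (fine (L ^ k) M) μ) - G k x * Rc k x μ‖ ≤ mG k)
    (hblock : ∀ k z j, ‖G k (bpt (L ^ k) M z j) - c k z * T k (bpt (L ^ k) M z j)‖ ≤ mB k)
    (hsmall : ∀ k, 16 * (d : ℝ) ^ 2 * (((L ^ k : ℕ) : ℝ) * mG k) ^ 2 + 4 * mB k ^ 2 ≤ 1 / 2)
    (hG' : ∀ k x, ‖G' k x‖ = 1) (hc' : ∀ k y, ‖c' k y‖ ≤ 1)
    (hframe' : ∀ k x μ, ‖G' k (x + unitVec (fine L (fine (L ^ k) M)) μ) - G' k x * R' k x μ‖ ≤ mG' k)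
    (hblock' : ∀ k y j, ‖G' k (bpt L (fine (L ^ k) M) y j) - c' k y * T' k (bpt L (fine (L ^ k) M) y j)‖ ≤ mB' k)
    (hsmall' : ∀ k, 16 * (d : ℝ) ^ 2 * ((L : ℝ) * mG' k) ^ 2 + 4 * mB' k ^ 2 ≤ 1 / 2)
    (hR' : ∀ k x μ, ‖R' k x μ‖ ≤ 1) (hT'le : ∀ k x, ‖T' k x‖ ≤ 1) (hT'1 : ∀ k x, ‖T' k x‖ = 1) (hm : ∀ k, 0 ≤ m k)
    (hmis : ∀ k y μ j, ‖mis L (fine (L ^ k) M) (Rc k) (R' k) (T' k) y μ j‖ ≤ m k)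
    (habsorb : ∀ k, 512 * (d : ℝ) ^ 2 * (((L ^ k : ℕ) : ℝ) * m k) ^ 2 ≤ 1 / 2)
    (hCR : 0 ≤ CR) {ε₂ : ℕ → ℝ} (hε₁ : ∀ k, 0 ≤ ε₁ k) (hε₂ : ∀ k, 0 ≤ ε₂ k)
    (hONEadd : ∀ k f, blockSpin (Q1 (L ^ k) L M (T' k)) (Sf (L ^ k) L M (R' k)) f
      ≤ Sc (L ^ k) M (Rc k) f + ε₁ k * ρ k f + ε₂ k * qW (L ^ k) M f)
    (hREG : ∀ k (μ : Tor M → ℂ) f, Qk (L ^ k) M (T k) f = μ → (∀ g, Qk (L ^ k) M (T k) g = μ → Sc (L ^ k) M (Rc k) f ≤ Sc (L ^ k) M (Rc k) g) →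
      ρ k f ≤ CR * (Sc (L ^ k) M (Rc k) f + nsq μ))
    {a : ℝ} (ha : 0 < a) :
    OneStepAveragedLaw (ι := fun _ => Tor M) (fun _ => (1 : Matrix (Tor M) (Tor M) ℂ)) 1
      (fun k => effSc (L ^ k) M (Rc k) (T k) a)
      (fun k => max (eFED d (Real.sqrt d * (((L ^ k : ℕ) : ℝ) * m k))
          (LamSeq (4 * d) (fun j => ε₁ j * CR + ε₂ j * (1088 * d + 128)) (k + 1)))
        ((ε₁ k * CR + ε₂ k * (1088 * d + 128)) * (LamSeq (4 * d) (fun j => ε₁ j * CR + ε₂ j * (1088 * d + 128)) (k + 1) + 1))) := by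
  set Λ : ℕ → ℝ := LamSeq (4 * d) (fun j => ε₁ j * CR + ε₂ j * (1088 * d + 128)) with hΛdef
  have hee : ∀ j, 0 ≤ ε₁ j * CR + ε₂ j * (1088 * (d : ℝ) + 128) := fun j => by
    have := hε₁ j; have := hε₂ j; positivity
  have hΛ0 : ∀ k, 0 ≤ Λ k := LamSeq_nonneg (by positivity) hee
  have hΛmono : ∀ k, Λ k ≤ Λ (k + 1) := LamSeq_le_succ (by positivity) hee
  have hUB := ubAll_of_ub_tower L M Rc T R' T' G c mG mB CR ε₁ ρ hTcomp hRtr hT hRc0 hG hc hframe hblock hsmall hT'1 hCR hε₁ hε₂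
    hONEadd hREG
  refine oneStepAveragedLaw_effSc_of_pairs L M Rc T R' T' hT (CP := fun _ => 1088 * d + 128)
    (fun k f => qW_le_coarse (L ^ k) M (hG k) (hc k) (hframe k) (hblock k) (hsmall k) f) hTcomp hRtr ha _ _
    (fun k => eFED_nonneg d (by have := hm k; positivity) (hΛ0 (k + 1))) fun k μ => ?_
  have hUBc := ub_mono L M Rc T k (hΛmono k) (hUB k)
  have hUBf := ubf_of_succ L M Rc T R' T' hTcomp hRtr k (hUB (k + 1))
  have h := VariationalCovariantScalarPair.scalar_pair_bracket (L ^ k) L M (hG k) (hc k) (hframe k) (hblock k) (hsmall k) (hG' k) (hc' k)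
    (hframe' k) (hblock' k) (hsmall' k) (hR' k) (hT'le k) (hT'1 k) (hm k) (hmis k) (habsorb k) (hΛ0 (k + 1)) hCR (hε₁ k) (hε₂ k)
    hUBc hUBf (hONEadd k) (hREG k) μ
  unfold eFED
  exact h

/-! ## §6 The honest (sqrt) world with UB⁺ DISCHARGED by `ub_tower_sqrt` (binders: data, frames, ONE′, REG⁺ only) -/

/-- the per-level defect driving the sqrt UB⁺-induction: `ẽ_j = ε₁,j C_R + 2δ′_j√((1 + ε₁,j C_R)·C_P) + δ′_j²·C_P` (`ub_tower_sqrt`'s recursion),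
`C_P = 1088d + 128`. [folklore] -/
def eUB (d : ℕ) (CR ε₁ δ' : ℝ) : ℝ :=
  ε₁ * CR + 2 * δ' * Real.sqrt ((1 + ε₁ * CR) * (1088 * d + 128)) + δ' ^ 2 * (1088 * d + 128)

/-- `eUB ≥ 0`. [folklore] -/
theorem eUB_nonneg (d : ℕ) {CR ε₁ δ' : ℝ} (hCR : 0 ≤ CR) (hε₁ : 0 ≤ ε₁) (hδ' : 0 ≤ δ') : 0 ≤ eUB d CR ε₁ δ' := by
  unfold eUB; positivity

/-- **UB⁺ AT EVERY LEVEL ON THE CONCRETE TOWER, honest (sqrt) ONE′ world**: `ub_level_zero` + leaf-09's abstract induction `ub_tower_sqrt`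
instantiated exactly as `ubAll_of_ub_tower` (`W k := level-L^k fields`, `Q₁ k := Q1tow`, `hcomp := Qk_compT_eq_comp`, `hONE′` through
`blockSpin_Q1tow`): `Λ_k = LamSeq (4d) (j ↦ eUB d C_R ε₁,j δ′_j) k`. [folklore] -/
theorem ubAll_of_ub_tower_sqrt
    (hTcomp : ∀ k, T (k + 1) = compT (L ^ k) L M (T k) (T' k)) (hRtr : ∀ k, Rc (k + 1) = Rtr (L ^ k) L M (R' k))
    (hT : ∀ k x, ‖T k x‖ = 1) (hRc0 : ∀ y μ, ‖Rc 0 y μ‖ ≤ 1)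
    (hG : ∀ k x, ‖G k x‖ = 1) (hc : ∀ k z, ‖c k z‖ ≤ 1)
    (hframe : ∀ k x μ, ‖G k (x + unitVec (fine (L ^ k) M) μ) - G k x * Rc k x μ‖ ≤ mG k)
    (hblock : ∀ k z j, ‖G k (bpt (L ^ k) M z j) - c k z * T k (bpt (L ^ k) M z j)‖ ≤ mB k)
    (hsmall : ∀ k, 16 * (d : ℝ) ^ 2 * (((L ^ k : ℕ) : ℝ) * mG k) ^ 2 + 4 * mB k ^ 2 ≤ 1 / 2)
    (hT'1 : ∀ k x, ‖T' k x‖ = 1) (hCR : 0 ≤ CR) (hε₁ : ∀ k, 0 ≤ ε₁ k) (hδ' : ∀ k, 0 ≤ δ' k) (hρ0 : ∀ k f, 0 ≤ ρ k f)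
    (hONE : ∀ k f, blockSpin (Q1 (L ^ k) L M (T' k)) (Sf (L ^ k) L M (R' k)) f
      ≤ (Real.sqrt (Sc (L ^ k) M (Rc k) f + ε₁ k * ρ k f) + δ' k * Real.sqrt (qW (L ^ k) M f)) ^ 2)
    (hREG : ∀ k (μ : Tor M → ℂ) f, Qk (L ^ k) M (T k) f = μ → (∀ g, Qk (L ^ k) M (T k) g = μ → Sc (L ^ k) M (Rc k) f ≤ Sc (L ^ k) M (Rc k) g) →
      ρ k f ≤ CR * (Sc (L ^ k) M (Rc k) f + nsq μ)) :
    ∀ k (μ : Tor M → ℂ), ∃ f, Qk (L ^ k) M (T k) f = μ ∧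
      Sc (L ^ k) M (Rc k) f ≤ LamSeq (4 * d) (fun j => eUB d CR (ε₁ j) (δ' j)) k * nsq μ := by
  have h := ub_tower_sqrt (W := fun k => Tor (fine (L ^ k) M) → ℂ) (Z := Tor M → ℂ)
    (Q₁ := fun k => Q1tow (L ^ k) L M (T' k)) (Qk := fun k => Qk (L ^ k) M (T k)) ?_
    (S := fun k => Sc (L ^ k) M (Rc k)) (q := fun k => qW (L ^ k) M) (ρ := ρ) (qZ := nsq)
    (fun k => continuous_Qc (T k)) (fun k => continuous_Q1tow L M (L ^ k) (T' k)) (fun k => ?_)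
    (fun k => surjective_Q1tow L M (L ^ k) (hT'1 k)) (fun k f => Sc_nonneg (L ^ k) M (Rc k) f)
    (fun k f => VariationalCovariantScalarPair.qW_nonneg (L ^ k) M f) hρ0 (fun μ => nsq_nonneg μ)
    (κ := fun k => (((L ^ k : ℕ) : ℝ)) ^ d) (CP := 1088 * d + 128) (CR := CR) (Λ₀ := 4 * d) (ε₁ := ε₁) (δ' := δ')
    (fun k => by positivity) (by positivity) hCR (by positivity) hε₁ hδ'
    (fun k f => norm_sq_le_qW (L ^ k) M f)
    (fun k f => qW_le_coarse (L ^ k) M (hG k) (hc k) (hframe k) (hblock k) (hsmall k) f)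
    (fun k f => ?_) hREG (fun μ => ub_level_zero M hRc0 (hT 0) μ)
  · intro k μ
    obtain ⟨f, hf, hb⟩ := h k μ
    exact ⟨f, hf, by simpa only [eUB] using hb⟩
  · intro k
    show Qk (L ^ (k + 1)) M (T (k + 1)) = Qk (L ^ k) M (T k) ∘ Q1tow (L ^ k) L M (T' k)
    rw [hTcomp k]
    exact Qk_compT_eq_comp (L ^ k) L M (T k) (T' k)
  · exact continuous_sum_dirU (Rc k) _
  · show blockSpin (Q1tow (L ^ k) L M (T' k)) (Sc (L ^ (k + 1)) M (Rc (k + 1))) f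
      ≤ (Real.sqrt (Sc (L ^ k) M (Rc k) f + ε₁ k * ρ k f) + δ' k * Real.sqrt (qW (L ^ k) M f)) ^ 2
    have hS : Sc (L ^ (k + 1)) M (Rc (k + 1)) = Sc (L ^ k * L) M (Rtr (L ^ k) L M (R' k)) := by
      rw [hRtr k]; rfl
    rw [hS, blockSpin_Q1tow]
    exact hONE k f

/-- **THE TOWER LAW IN THE HONEST (sqrt) ONE′ WORLD WITH UB⁺ DISCHARGED**: binders = COMP⁺ data identities, unimodular transports, contractive
phases, per-level small-field frames, mismatch absorption, and the typed leaf shapes ONE′ (`VariationalCovariantOneStepPhys.blockSpin_Q1_le`) and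
REG⁺ (`VariationalCovariantRegularityRho.hREG_rho`) ⟹ `OneStepAveragedLaw (fun _ ↦ 1) 1 (k ↦ effSc (L^k) M (Rc k) (T k) a) (k ↦ max (eFED …) (eONE …))`
at `Λ = LamSeq (4d) (j ↦ eUB d C_R ε₁,j δ′_j)` (Grönwall: `LamSeq_add_one_le`).  ONE′ ∕ REG⁺ ∕ class bounds: the owner's «P2-END».
Nothing of NE3; NE2 NOT proved. [folklore] -/
theorem oneStepAveragedLaw_scalarTower_sqrt_ub
    (hTcomp : ∀ k, T (k + 1) = compT (L ^ k) L M (T k) (T' k)) (hRtr : ∀ k, Rc (k + 1) = Rtr (L ^ k) L M (R' k))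
    (hT : ∀ k x, ‖T k x‖ = 1) (hRc0 : ∀ y μ, ‖Rc 0 y μ‖ ≤ 1)
    (hG : ∀ k x, ‖G k x‖ = 1) (hc : ∀ k z, ‖c k z‖ ≤ 1)
    (hframe : ∀ k x μ, ‖G k (x + unitVec (fine (L ^ k) M) μ) - G k x * Rc k x μ‖ ≤ mG k)
    (hblock : ∀ k z j, ‖G k (bpt (L ^ k) M z j) - c k z * T k (bpt (L ^ k) M z j)‖ ≤ mB k)
    (hsmall : ∀ k, 16 * (d : ℝ) ^ 2 * (((L ^ k : ℕ) : ℝ) * mG k) ^ 2 + 4 * mB k ^ 2 ≤ 1 / 2)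
    (hG' : ∀ k x, ‖G' k x‖ = 1) (hc' : ∀ k y, ‖c' k y‖ ≤ 1)
    (hframe' : ∀ k x μ, ‖G' k (x + unitVec (fine L (fine (L ^ k) M)) μ) - G' k x * R' k x μ‖ ≤ mG' k)
    (hblock' : ∀ k y j, ‖G' k (bpt L (fine (L ^ k) M) y j) - c' k y * T' k (bpt L (fine (L ^ k) M) y j)‖ ≤ mB' k)
    (hsmall' : ∀ k, 16 * (d : ℝ) ^ 2 * ((L : ℝ) * mG' k) ^ 2 + 4 * mB' k ^ 2 ≤ 1 / 2)
    (hR' : ∀ k x μ, ‖R' k x μ‖ ≤ 1) (hT'le : ∀ k x, ‖T' k x‖ ≤ 1) (hT'1 : ∀ k x, ‖T' k x‖ = 1) (hm : ∀ k, 0 ≤ m k)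
    (hmis : ∀ k y μ j, ‖mis L (fine (L ^ k) M) (Rc k) (R' k) (T' k) y μ j‖ ≤ m k)
    (habsorb : ∀ k, 512 * (d : ℝ) ^ 2 * (((L ^ k : ℕ) : ℝ) * m k) ^ 2 ≤ 1 / 2)
    (hCR : 0 ≤ CR) (hε₁ : ∀ k, 0 ≤ ε₁ k) (hδ' : ∀ k, 0 ≤ δ' k) (hρ0 : ∀ k f, 0 ≤ ρ k f)
    (hONE : ∀ k f, blockSpin (Q1 (L ^ k) L M (T' k)) (Sf (L ^ k) L M (R' k)) f
      ≤ (Real.sqrt (Sc (L ^ k) M (Rc k) f + ε₁ k * ρ k f) + δ' k * Real.sqrt (qW (L ^ k) M f)) ^ 2)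
    (hREG : ∀ k (μ : Tor M → ℂ) f, Qk (L ^ k) M (T k) f = μ → (∀ g, Qk (L ^ k) M (T k) g = μ → Sc (L ^ k) M (Rc k) f ≤ Sc (L ^ k) M (Rc k) g) →
      ρ k f ≤ CR * (Sc (L ^ k) M (Rc k) f + nsq μ))
    {a : ℝ} (ha : 0 < a) :
    OneStepAveragedLaw (ι := fun _ => Tor M) (fun _ => (1 : Matrix (Tor M) (Tor M) ℂ)) 1
      (fun k => effSc (L ^ k) M (Rc k) (T k) a)
      (fun k => max (eFED d (Real.sqrt d * (((L ^ k : ℕ) : ℝ) * m k)) (LamSeq (4 * d) (fun j => eUB d CR (ε₁ j) (δ' j)) (k + 1)))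
        (eONE d (LamSeq (4 * d) (fun j => eUB d CR (ε₁ j) (δ' j)) (k + 1)) CR (ε₁ k) (δ' k))) := by
  have hee : ∀ j, 0 ≤ eUB d CR (ε₁ j) (δ' j) := fun j => eUB_nonneg d hCR (hε₁ j) (hδ' j)
  exact oneStepAveragedLaw_scalarTower_sqrt L M Rc T R' T' G c mG mB G' c' mG' mB' m
    (LamSeq (4 * d) (fun j => eUB d CR (ε₁ j) (δ' j))) CR ε₁ δ' ρ hTcomp hRtr hT hG hc hframe hblock hsmall hG' hc' hframe' hblock'
    hsmall' hR' hT'le hT'1 hm hmis habsorb (LamSeq_nonneg (by positivity) hee) (LamSeq_le_succ (by positivity) hee) hCR hε₁ hδ' hρ0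
    (ubAll_of_ub_tower_sqrt L M Rc T R' T' G c mG mB CR ε₁ δ' ρ hTcomp hRtr hT hRc0 hG hc hframe hblock hsmall hT'1 hCR hε₁ hδ' hρ0
      hONE hREG) hONE hREG ha

end Tower

end Summit.QuantumFields.BalabanUV.T4Continuum.VariationalCovariantTowerLaw

end
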